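import Mathlib

set_option linter.dupNamespace false
set_option linter.unusedSectionVars false

/-!
# DisperseArithmeticA (lens 4, g29; the numeric side conditions of the (c0) dispersing branch) — EXPLICIT SUFFICIENT PARAMETER BOUNDS

Blocker `X = AbsorptionDial.NoPerfectPolyOdd` (item 28487); decomp-qadv lens 4, g29.  `ColumnBridgeC.loss_of_Free` carries three numeric
hypotheses.  This file reduces two of them to explicit, polynomial-size lower bounds on the parameters (the third, `hcountB : … < 2 ^ r`, is met
by choosing the cut size `r` one above a base-2 logarithm, `Nat.lt_pow_succ_log_self`):

* ★ `hsmall_of` — `3 p^{K} (cos(π/3p)^w + √(E + 4^s cos(π/p)^{w₂}) / 2^s) < 1` (`K = r + k + 1`) as soon as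
  `w ≥ 4p²(3 + K p)`, `w₂ ≥ 4p²(6 + 2 K p)` and `324 · p^{2K} · E ≤ 4^s`; via `cos x ≤ 1/√(1+x²) ≤ exp(−x²/4)` (`inv_sqrt_le_exp`,
  `cos_pow_le`), `exp(−(a + K p)) ≤ e^{−a} / p^K` (`exp_neg_le`) and `cos(π/3p), cos(π/p) ≤ cos(1/p)`;
* ★ `hcountA_of` — `(n+1) · 2p^k · (2p−1)^m < (2p)^m` as soon as `m ≥ (2p−1) t` with `2^t > (n+1) · 2p^k`; via `2 (2p−1)^{2p−1} ≤ (2p)^{2p−1}`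
  (Bernoulli, `two_mul_pow_le`).

So every side condition of the dispersing branch is met by parameters of size `poly(p, k, log n)` — with `k ≤ (log n)^C` labels, polylogarithmic.

Supports stmt-QuantumAdvantage-28487 (record; the residual `X` is NOT claimed).
-/

open Real

namespace Summit.QuantumAdvantage.QuantumAdvantage.Theorems.DisperseArithmetic

/-- `1/√(x²+1) ≤ exp(−x²/4)` for `x² ≤ 1` -/
theorem inv_sqrt_le_exp {x : ℝ} (hx : x ^ 2 ≤ 1) : 1 / √(x ^ 2 + 1) ≤ Real.exp (-(x ^ 2 / 4)) := by
  have h1 : Real.exp (x ^ 2 / 2) ≤ x ^ 2 + 1 := by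
    have hb := Real.abs_exp_sub_one_sub_id_le (x := x ^ 2 / 2)
      (by rw [abs_of_nonneg (by positivity)]; nlinarith)
    have h := (abs_le.mp hb).2
    nlinarith [sq_nonneg x]
  have h2 : Real.exp (x ^ 2 / 4) ≤ √(x ^ 2 + 1) := by
    have h3 : Real.exp (x ^ 2 / 4) = √(Real.exp (x ^ 2 / 2)) := by
      rw [show x ^ 2 / 2 = (2 : ℕ) * (x ^ 2 / 4) by push_cast; ring, Real.exp_nat_mul,
        Real.sqrt_sq (Real.exp_pos _).le]
    rw [h3]
    exact Real.sqrt_le_sqrt h1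
  rw [Real.exp_neg, ← one_div]
  exact one_div_le_one_div_of_le (Real.exp_pos _) h2

/-- `cos x ^ w ≤ exp(−w x²/4)` for `0 ≤ x ≤ 1` -/
theorem cos_pow_le {x : ℝ} (h0 : 0 ≤ x) (h1 : x ≤ 1) (w : ℕ) :
    Real.cos x ^ w ≤ Real.exp (-(w * x ^ 2 / 4)) := by
  have hc0 : 0 ≤ Real.cos x :=
    Real.cos_nonneg_of_neg_pi_div_two_le_of_le (by linarith [Real.pi_pos]) (by linarith [Real.pi_gt_three])
  have hcx : Real.cos x ≤ Real.exp (-(x ^ 2 / 4)) :=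
    (Real.cos_le_one_div_sqrt_sq_add_one (by linarith [Real.pi_pos]) (by linarith [Real.pi_gt_three])).trans
      (inv_sqrt_le_exp (by nlinarith))
  calc Real.cos x ^ w ≤ Real.exp (-(x ^ 2 / 4)) ^ w := pow_le_pow_left₀ hc0 hcx w
    _ = Real.exp (-(w * x ^ 2 / 4)) := by
        rw [← Real.exp_nat_mul]
        ring_nf

/-- `exp(−(a + K p)) ≤ exp(−a) / p^K` for `p ≥ 1` (`p ≤ exp p`) -/
theorem exp_neg_le (a : ℝ) (K : ℕ) {p : ℝ} (hp : 1 ≤ p) :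
    Real.exp (-(a + K * p)) ≤ Real.exp (-a) / p ^ K := by
  have hpK : 0 < p ^ K := by positivity
  have hle : p ^ K ≤ Real.exp (K * p) := by
    rw [Real.exp_nat_mul]
    exact pow_le_pow_left₀ (by linarith) (by linarith [Real.add_one_le_exp p]) K
  rw [neg_add, Real.exp_add, div_eq_mul_inv, Real.exp_neg (K * p)]
  exact mul_le_mul_of_nonneg_left (inv_anti₀ hpK hle) (Real.exp_pos _).le

/-- `cos(π/(p·3)) ≤ cos(1/p)` and `cos(π/p) ≤ cos(1/p)`, both with `0 ≤` the left side, for `p ≥ 2` -/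
theorem cos_pi_div_le {p : ℝ} (hp : 2 ≤ p) :
    Real.cos (Real.pi / (p * 3)) ≤ Real.cos (1 / p) ∧ Real.cos (Real.pi / p) ≤ Real.cos (1 / p)
      ∧ 0 ≤ Real.cos (Real.pi / (p * 3)) ∧ 0 ≤ Real.cos (Real.pi / p) := by
  have hp0 : 0 < p := by linarith
  have hπ := Real.pi_gt_three
  refine ⟨?_, ?_, ?_, ?_⟩
  · apply Real.cos_le_cos_of_nonneg_of_le_pi (by positivity)
    · rw [div_le_iff₀ (by positivity)]; nlinarith [Real.pi_pos]
    · rw [div_le_div_iff₀ hp0 (by positivity)]; nlinarith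
  · apply Real.cos_le_cos_of_nonneg_of_le_pi (by positivity)
    · rw [div_le_iff₀ hp0]; nlinarith [Real.pi_pos]
    · exact div_le_div_of_nonneg_right (by linarith) hp0.le
  · apply Real.cos_nonneg_of_neg_pi_div_two_le_of_le
    · have : 0 ≤ Real.pi / (p * 3) := by positivity
      linarith [Real.pi_pos]
    · rw [div_le_div_iff₀ (by positivity) (by norm_num)]; nlinarith [Real.pi_pos]
  · apply Real.cos_nonneg_of_neg_pi_div_two_le_of_le
    · have : 0 ≤ Real.pi / p := by positivity
      linarith [Real.pi_pos]
    · rw [div_le_div_iff₀ hp0 (by norm_num)]; nlinarith [Real.pi_pos]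

/-- **`hsmall` FROM EXPLICIT BOUNDS.**  With `K = r + k + 1`: `w ≥ 4p²(3 + K p)`, `w₂ ≥ 4p²(6 + 2 K p)` and `324 p^{2K} E ≤ 4^s` give the
numeric hypothesis `hsmall` of `ColumnBridge.loss_of_freeDisperse` / `ColumnBridgeC.loss_of_Free`. -/
theorem hsmall_of {p r k w w₂ s E : ℕ} (hp5 : 5 ≤ p) (hw : 4 * p ^ 2 * (3 + (r + k + 1) * p) ≤ w)
    (hw₂ : 4 * p ^ 2 * (6 + 2 * (r + k + 1) * p) ≤ w₂) (hE : 324 * p ^ (2 * (r + k + 1)) * E ≤ 4 ^ s) :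
    3 * (p : ℝ) ^ (r + k + 1) *
      (Real.cos (Real.pi / (p * 3)) ^ w
        + Real.sqrt (E + 4 ^ s * Real.cos (Real.pi / p) ^ w₂) / 2 ^ s) < 1 := by
  set K := r + k + 1 with hK
  have hp2 : (2 : ℝ) ≤ p := by exact_mod_cast (by omega : 2 ≤ p)
  have hp1 : (1 : ℝ) ≤ p := by linarith
  have hp0 : (0 : ℝ) < p := by linarith
  obtain ⟨hc3, hc1, hc3nn, hc1nn⟩ := cos_pi_div_le hp2
  have hpK : (0 : ℝ) < (p : ℝ) ^ K := by positivity
  set δ : ℝ := 1 / (9 * (p : ℝ) ^ K) with hδ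
  have hδ0 : 0 < δ := by positivity
  -- the base estimate `cos(1/p)^v ≤ exp(−v/(4p²))`
  have hbase : ∀ v : ℕ, Real.cos (1 / (p : ℝ)) ^ v ≤ Real.exp (-(v * (1 / (p : ℝ)) ^ 2 / 4)) :=
    fun v => cos_pow_le (by positivity) (by rw [div_le_one hp0]; exact hp1) v
  -- first term
  have hA : Real.cos (Real.pi / (p * 3)) ^ w ≤ δ := by
    have hwR : (4 : ℝ) * p ^ 2 * (3 + K * p) ≤ w := by exact_mod_cast hw
    calc Real.cos (Real.pi / (p * 3)) ^ w ≤ Real.cos (1 / (p : ℝ)) ^ w := pow_le_pow_left₀ hc3nn hc3 w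
      _ ≤ Real.exp (-(w * (1 / (p : ℝ)) ^ 2 / 4)) := hbase w
      _ ≤ Real.exp (-(3 + K * p)) := by
          rw [Real.exp_le_exp, neg_le_neg_iff]
          rw [div_pow, one_pow, le_div_iff₀ (by norm_num), mul_one_div, le_div_iff₀ (by positivity)]
          linarith
      _ ≤ Real.exp (-3) / (p : ℝ) ^ K := exp_neg_le 3 K hp1
      _ ≤ δ := by
          rw [hδ, div_le_div_iff₀ hpK (by positivity)]
          have he : Real.exp (-3) ≤ 1 / 9 := by
            rw [Real.exp_neg, ← one_div]
            apply one_div_le_one_div_of_le (by norm_num)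
            have h1 : (2.7 : ℝ) ≤ Real.exp 1 := by linarith [Real.exp_one_gt_d9]
            have h3 : Real.exp 3 = Real.exp 1 ^ 3 := by rw [← Real.exp_nat_mul]; norm_num
            rw [h3]
            calc (9 : ℝ) ≤ 2.7 ^ 3 := by norm_num
              _ ≤ Real.exp 1 ^ 3 := pow_le_pow_left₀ (by norm_num) h1 3
          nlinarith
  -- second term
  have hC : Real.cos (Real.pi / p) ^ w₂ ≤ δ ^ 2 / 2 := by
    have hwR : (4 : ℝ) * p ^ 2 * (6 + 2 * K * p) ≤ w₂ := by exact_mod_cast hw₂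
    calc Real.cos (Real.pi / p) ^ w₂ ≤ Real.cos (1 / (p : ℝ)) ^ w₂ := pow_le_pow_left₀ hc1nn hc1 w₂
      _ ≤ Real.exp (-(w₂ * (1 / (p : ℝ)) ^ 2 / 4)) := hbase w₂
      _ ≤ Real.exp (-(6 + (2 * K : ℕ) * p)) := by
          rw [Real.exp_le_exp, neg_le_neg_iff]
          push_cast
          rw [div_pow, one_pow, le_div_iff₀ (by norm_num), mul_one_div, le_div_iff₀ (by positivity)]
          linarith
      _ ≤ Real.exp (-6) / (p : ℝ) ^ (2 * K) := exp_neg_le 6 (2 * K) hp1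
      _ ≤ (1 / 162) / (p : ℝ) ^ (2 * K) := by
          refine div_le_div_of_nonneg_right ?_ (by positivity)
          rw [Real.exp_neg, ← one_div]
          apply one_div_le_one_div_of_le (by norm_num)
          have h1 : (2.7 : ℝ) ≤ Real.exp 1 := by linarith [Real.exp_one_gt_d9]
          have h3 : Real.exp 6 = Real.exp 1 ^ 6 := by rw [← Real.exp_nat_mul]; norm_num
          rw [h3]
          calc (162 : ℝ) ≤ 2.7 ^ 6 := by norm_num
            _ ≤ Real.exp 1 ^ 6 := pow_le_pow_left₀ (by norm_num) h1 6
      _ = δ ^ 2 / 2 := by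
          rw [hδ, pow_mul']
          field_simp
          ring
  have hEr : (E : ℝ) ≤ 4 ^ s * (δ ^ 2 / 4) := by
    have hE' : (324 : ℝ) * ((p : ℝ) ^ K) ^ 2 * E ≤ 4 ^ s := by
      rw [← pow_mul']
      exact_mod_cast hE
    have h324 : (4 : ℝ) ^ s * (δ ^ 2 / 4) = 4 ^ s / (324 * ((p : ℝ) ^ K) ^ 2) := by
      rw [hδ]
      field_simp
      ring
    rw [h324, le_div_iff₀ (by positivity)]
    have hcomm : (E : ℝ) * (324 * ((p : ℝ) ^ K) ^ 2) = 324 * ((p : ℝ) ^ K) ^ 2 * E := by ring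
    rw [hcomm]
    exact hE'
  have hB : Real.sqrt (E + 4 ^ s * Real.cos (Real.pi / p) ^ w₂) / 2 ^ s ≤ δ := by
    rw [div_le_iff₀ (by positivity)]
    have h4 : (E : ℝ) + 4 ^ s * Real.cos (Real.pi / p) ^ w₂ ≤ (δ * 2 ^ s) ^ 2 := by
      have : (δ * 2 ^ s) ^ 2 = 4 ^ s * δ ^ 2 := by
        rw [mul_pow, ← pow_mul, show (4 : ℝ) = 2 ^ 2 by norm_num, ← pow_mul]; ring
      rw [this]
      have h4s : (0 : ℝ) ≤ 4 ^ s := by positivity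
      nlinarith [mul_le_mul_of_nonneg_left hC h4s]
    calc Real.sqrt (E + 4 ^ s * Real.cos (Real.pi / p) ^ w₂) ≤ Real.sqrt ((δ * 2 ^ s) ^ 2) := Real.sqrt_le_sqrt h4
      _ = δ * 2 ^ s := Real.sqrt_sq (by positivity)
  calc 3 * (p : ℝ) ^ K * (Real.cos (Real.pi / (p * 3)) ^ w + Real.sqrt (E + 4 ^ s * Real.cos (Real.pi / p) ^ w₂) / 2 ^ s)
      ≤ 3 * (p : ℝ) ^ K * (δ + δ) := by gcongr
    _ = 2 / 3 := by rw [hδ]; field_simp; ring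
    _ < 1 := by norm_num

/-- Bernoulli: `2 q^q ≤ (q+1)^q` for `q ≥ 1` -/
theorem two_mul_pow_le (q : ℕ) (hq : 1 ≤ q) : 2 * q ^ q ≤ (q + 1) ^ q := by
  have hqR : (0 : ℝ) < q := by exact_mod_cast hq
  have hB := one_add_mul_le_pow (a := 1 / (q : ℝ)) (by rw [one_div]; linarith [inv_pos.mpr hqR]) q
  rw [mul_one_div_cancel hqR.ne'] at hB
  have h : (2 : ℝ) * (q : ℝ) ^ q ≤ ((q : ℝ) + 1) ^ q := by
    have : ((q : ℝ) + 1) ^ q = (q : ℝ) ^ q * (1 + 1 / (q : ℝ)) ^ q := by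
      rw [← mul_pow]; congr 1; field_simp
    rw [this]
    have hqq : (0 : ℝ) < (q : ℝ) ^ q := by positivity
    nlinarith
  exact_mod_cast h

/-- **`hcountA` FROM EXPLICIT BOUNDS.**  `m ≥ (2p − 1) t` with `2^t > (n+1) · 2p^k` gives the numeric hypothesis `hcountA`. -/
theorem hcountA_of {p n k m t : ℕ} (hp : 1 ≤ p) (hm : (2 * p - 1) * t ≤ m) (ht : (n + 1) * (p ^ k * 2) < 2 ^ t) :
    (n + 1) * (p ^ k * 2) * (2 * p - 1) ^ m < (2 * p) ^ m := by
  set q := 2 * p - 1 with hq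
  have hq1 : 1 ≤ q := by omega
  have h2p : 2 * p = q + 1 := by omega
  obtain ⟨e, he⟩ : ∃ e, m = q * t + e := ⟨m - q * t, by omega⟩
  have hkey : 2 ^ t * q ^ m ≤ (2 * p) ^ m := by
    rw [h2p, he, pow_add, pow_add, pow_mul, pow_mul]
    calc 2 ^ t * ((q ^ q) ^ t * q ^ e) = (2 * q ^ q) ^ t * q ^ e := by rw [mul_pow]; ring
      _ ≤ ((q + 1) ^ q) ^ t * (q + 1) ^ e :=
          Nat.mul_le_mul (Nat.pow_le_pow_left (two_mul_pow_le q hq1) t) (Nat.pow_le_pow_left (by omega) e)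
  have hqm : 0 < q ^ m := by positivity
  calc (n + 1) * (p ^ k * 2) * q ^ m < 2 ^ t * q ^ m := Nat.mul_lt_mul_of_pos_right ht hqm
    _ ≤ (2 * p) ^ m := hkey

end Summit.QuantumAdvantage.QuantumAdvantage.Theorems.DisperseArithmetic
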